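import Summits.AtomisticToContinuum.FouriersLaw.Theorems.OddSectorIrreversibilityOddDensityIsCorrectorResolventL2

/-!
# `OddDensityIsCorrector`, part 10: Abel means, `λ R_λ f → μ_T(f)` and `R_λ f → R₀ f` as `λ → 0`

Helper file for support item `stmt-AtomisticToContinuum-9146`
(`OddSectorIrreversibility.OddDensityIsCorrector`).

Quantitative `λ → 0` limits of the resolvent of the equilibrium kernels of the pinned anharmonic
chain on nice observables `f` (continuous, `|f| ≤ C e^{ϑH}`, `0 < ϑ < 1/T`), from the Harris bound
`|P_t f(z) - μ_T(f)| ≤ K C e^{ϑH(z)} e^{-ct}` (`pinnedChain_harris_bound`):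

* `pinnedChain_abs_abelMean_sub_le` — `|λ R_λ f(z) - μ_T(f)| ≤ λ K C e^{ϑH(z)}/c` (mean ergodicity in
  Abel form, with rate);
* the Kubo integral `R₀ f(z) = ∫_{(0,∞)} P_t f(z) dt` of a CENTRED nice `f` (`μ_T(f) = 0`): absolute
  convergence (`pinnedChain_integrableOn_kubo`), the bound `|R₀ f(z)| ≤ K C e^{ϑH(z)}/c`, measurability,
  the convergence of the finite-horizon integrals `∫_{(0,τ]} P_t f(z) dt → R₀ f(z)`
  (`pinnedChain_tendsto_kubo`), and `|R_λ f(z) - R₀ f(z)| ≤ λ K C e^{ϑH(z)}/c²`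
  (`pinnedChain_abs_resolvent_sub_kubo_le`).

Nothing here closes an item.
-/

noncomputable section

open MeasureTheory ProbabilityTheory Filter Topology Set Function
open scoped ContDiff NNReal ENNReal
open Literature.MathematicalPhysics.KineticTheory.HeatConduction
open Summit.AtomisticToContinuum.FouriersLaw.Theorems.SubdiffusiveBondHeat

namespace Summit.AtomisticToContinuum.FouriersLaw.Theorems.OddSectorIrreversibility

variable {N : ℕ}

omit N in
/-- `∫_{(0,∞)} e^{-at} dt = 1/a` in the `-a * t` spelling. [folklore] -/
theorem integral_exp_neg_mul_Ioi' {a : ℝ} (ha : 0 < a) : ∫ t in Ioi (0 : ℝ), Real.exp (-a * t) = 1 / a := by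
  have h := integral_exp_mul_Ioi (a := -a) (by linarith) 0
  simp only [mul_zero, Real.exp_zero] at h
  rw [h]; field_simp

section Pinned

variable {ω₂ lam β γ : ℝ} (hω : 0 < ω₂) (hl : 0 ≤ lam) (hβ : 0 < β) (hγ : 0 < γ) (hN : 0 < N)
  {T : ℝ} (hT : 0 < T)
include hω hl hβ hγ hN hT

/-! ### Abel means -/

omit hN hT in
/-- **Abel-mean ergodicity with rate**: `|λ R_λ f(z) - μ_T(f)| ≤ λ K C e^{ϑH(z)} / c` for nice `f`,
`λ > 0` (`λ∫₀^∞ e^{-λt} dt = 1` and the Harris bound). [cite: CuneoEckmannHairerReyBellet2018, Thm 2.13] -/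
theorem pinnedChain_abs_abelMean_sub_le {ϑ K c : ℝ} (hϑ0 : 0 < ϑ)
    (hb : ∀ (z : PhaseSpace N) (t : ℝ≥0) (f : PhaseSpace N → ℝ), Continuous f →
      ∀ C : ℝ, 0 ≤ C → (∀ y, |f y| ≤ C * Real.exp (ϑ * (pinnedChain ω₂ lam β γ).hamiltonian N y)) →
      |(∫ y, f y ∂((pinnedChain ω₂ lam β γ).transitionKernel N T T t z)) -
          ∫ y, f y ∂((pinnedChain ω₂ lam β γ).gibbsMeasure N T)| ≤
        K * C * Real.exp (ϑ * (pinnedChain ω₂ lam β γ).hamiltonian N z) * Real.exp (-c * t))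
    (hc : 0 < c) {f : PhaseSpace N → ℝ} (hf : Continuous f) {C : ℝ} (hC : 0 ≤ C)
    (hfb : ∀ y, |f y| ≤ C * Real.exp (ϑ * (pinnedChain ω₂ lam β γ).hamiltonian N y))
    {lam' : ℝ} (hlam : 0 < lam') (z : PhaseSpace N) :
    |lam' * (∫ t in Ioi (0 : ℝ), Real.exp (-(lam' * t)) *
        ∫ y, f y ∂((pinnedChain ω₂ lam β γ).transitionKernel N T T t.toNNReal z)) -
        ∫ y, f y ∂((pinnedChain ω₂ lam β γ).gibbsMeasure N T)| ≤
      lam' * (K * C * Real.exp (ϑ * (pinnedChain ω₂ lam β γ).hamiltonian N z)) / c := by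
  set P := pinnedChain ω₂ lam β γ with hP
  set m := ∫ y, f y ∂(P.gibbsMeasure N T) with hm
  set E := Real.exp (ϑ * P.hamiltonian N z) with hE
  set u : ℝ → ℝ := fun t => ∫ y, f y ∂(P.transitionKernel N T T t.toNNReal z) with hu
  set w : ℝ → ℝ := fun t => Real.exp (-(lam' * t)) with hw
  have iwu : IntegrableOn (fun t => w t * u t) (Ioi 0) :=
    pinnedChain_integrableOn_resolvent hω hl hβ hγ hϑ0 hb hc hf hC hfb hlam z
  have hwi : IntegrableOn w (Ioi 0) := by
    have := exp_neg_integrableOn_Ioi 0 hlam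
    refine this.congr (Eventually.of_forall fun t => ?_); simp [hw, neg_mul]
  have hw1 : ∫ t in Ioi (0 : ℝ), w t = 1 / lam' := integral_exp_neg_mul_Ioi hlam
  -- `λ R f - m = λ ∫ w (u - m)`
  have e1 : lam' * (∫ t in Ioi (0 : ℝ), w t * u t) - m = lam' * ∫ t in Ioi (0 : ℝ), w t * (u t - m) := by
    have : ∫ t in Ioi (0 : ℝ), w t * (u t - m) = (∫ t in Ioi (0 : ℝ), w t * u t) - m * ∫ t in Ioi (0 : ℝ), w t := by
      rw [← integral_const_mul, ← integral_sub iwu (hwi.const_mul m)]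
      exact integral_congr_ae (Eventually.of_forall fun t => by ring)
    rw [this, hw1]
    field_simp
  rw [e1, abs_mul, abs_of_pos hlam]
  -- `|∫ w (u - m)| ≤ K C E ∫ e^{-ct} = K C E / c`
  have hdecay : IntegrableOn (fun t : ℝ => K * C * E * Real.exp (-c * t)) (Ioi 0) :=
    (exp_neg_integrableOn_Ioi 0 hc).const_mul _
  have hbd : ∀ᵐ t ∂(volume.restrict (Ioi (0 : ℝ))), ‖w t * (u t - m)‖ ≤ K * C * E * Real.exp (-c * t) := by
    refine (ae_restrict_iff' measurableSet_Ioi).2 (Eventually.of_forall fun t ht => ?_)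
    have h := hb z t.toNNReal f hf C hC hfb
    have ht' : 0 < t := ht
    rw [Real.coe_toNNReal t ht'.le] at h
    rw [norm_mul, Real.norm_eq_abs, Real.norm_eq_abs, abs_of_pos (Real.exp_pos _)]
    have hw1' : w t ≤ 1 := Real.exp_le_one_iff.2 (by nlinarith)
    have h0 : 0 ≤ |u t - m| := abs_nonneg _
    calc w t * |u t - m| ≤ 1 * |u t - m| := mul_le_mul_of_nonneg_right hw1' h0
      _ ≤ K * C * E * Real.exp (-c * t) := by rw [one_mul]; exact h
  have h := norm_integral_le_of_norm_le hdecay hbd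
  rw [Real.norm_eq_abs, integral_const_mul, integral_exp_neg_mul_Ioi' hc] at h
  calc lam' * |∫ t in Ioi (0 : ℝ), w t * (u t - m)| ≤ lam' * (K * C * E * (1 / c)) :=
        mul_le_mul_of_nonneg_left h hlam.le
    _ = lam' * (K * C * E) / c := by ring

/-! ### The Kubo integral of a centred nice observable -/

omit hN hT in
/-- **The Kubo integral converges absolutely** for a centred nice `f`: `t ↦ P_t f(z)` is integrable on
`(0, ∞)` (bounded by `K C e^{ϑH(z)} e^{-ct}`). [cite: CuneoEckmannHairerReyBellet2018, Thm 2.13] -/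
theorem pinnedChain_integrableOn_kubo {ϑ K c : ℝ}
    (hb : ∀ (z : PhaseSpace N) (t : ℝ≥0) (f : PhaseSpace N → ℝ), Continuous f →
      ∀ C : ℝ, 0 ≤ C → (∀ y, |f y| ≤ C * Real.exp (ϑ * (pinnedChain ω₂ lam β γ).hamiltonian N y)) →
      |(∫ y, f y ∂((pinnedChain ω₂ lam β γ).transitionKernel N T T t z)) -
          ∫ y, f y ∂((pinnedChain ω₂ lam β γ).gibbsMeasure N T)| ≤
        K * C * Real.exp (ϑ * (pinnedChain ω₂ lam β γ).hamiltonian N z) * Real.exp (-c * t))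
    (hc : 0 < c) {f : PhaseSpace N → ℝ} (hf : Continuous f) {C : ℝ} (hC : 0 ≤ C)
    (hfb : ∀ y, |f y| ≤ C * Real.exp (ϑ * (pinnedChain ω₂ lam β γ).hamiltonian N y))
    (hf0 : ∫ y, f y ∂((pinnedChain ω₂ lam β γ).gibbsMeasure N T) = 0) (z : PhaseSpace N) :
    IntegrableOn (fun t : ℝ => ∫ y, f y ∂((pinnedChain ω₂ lam β γ).transitionKernel N T T t.toNNReal z)) (Ioi 0) ∧
    ∀ t : ℝ, 0 ≤ t → |∫ y, f y ∂((pinnedChain ω₂ lam β γ).transitionKernel N T T t.toNNReal z)| ≤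
      K * C * Real.exp (ϑ * (pinnedChain ω₂ lam β γ).hamiltonian N z) * Real.exp (-c * t) := by
  set P := pinnedChain ω₂ lam β γ with hP
  set E := Real.exp (ϑ * P.hamiltonian N z) with hE
  have hpt : ∀ t : ℝ, 0 ≤ t → |∫ y, f y ∂(P.transitionKernel N T T t.toNNReal z)| ≤ K * C * E * Real.exp (-c * t) := by
    intro t ht
    have h := hb z t.toNNReal f hf C hC hfb
    rw [hf0, sub_zero, Real.coe_toNNReal t ht] at h
    exact h
  refine ⟨?_, hpt⟩
  have hmeas : AEStronglyMeasurable (fun t : ℝ => ∫ y, f y ∂(P.transitionKernel N T T t.toNNReal z))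
      (volume.restrict (Ioi 0)) :=
    ((pinnedChain_stronglyMeasurable_act_uncurry hω hl hβ.le hγ.le T T hf.measurable).comp_measurable
      (measurable_id.prodMk measurable_const : Measurable fun t : ℝ => (t, z))).aestronglyMeasurable
  refine Integrable.mono' ((exp_neg_integrableOn_Ioi 0 hc).const_mul (K * C * E)) hmeas ?_
  refine (ae_restrict_iff' measurableSet_Ioi).2 (Eventually.of_forall fun t ht => ?_)
  rw [Real.norm_eq_abs]
  exact hpt t (le_of_lt (show (0:ℝ) < t from ht))

omit hN hT in
/-- **Bound on the Kubo integral**: `|R₀ f(z)| ≤ K C e^{ϑH(z)} / c` for a centred nice `f`. [folklore] -/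
theorem pinnedChain_abs_kubo_le {ϑ K c : ℝ}
    (hb : ∀ (z : PhaseSpace N) (t : ℝ≥0) (f : PhaseSpace N → ℝ), Continuous f →
      ∀ C : ℝ, 0 ≤ C → (∀ y, |f y| ≤ C * Real.exp (ϑ * (pinnedChain ω₂ lam β γ).hamiltonian N y)) →
      |(∫ y, f y ∂((pinnedChain ω₂ lam β γ).transitionKernel N T T t z)) -
          ∫ y, f y ∂((pinnedChain ω₂ lam β γ).gibbsMeasure N T)| ≤
        K * C * Real.exp (ϑ * (pinnedChain ω₂ lam β γ).hamiltonian N z) * Real.exp (-c * t))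
    (hc : 0 < c) {f : PhaseSpace N → ℝ} (hf : Continuous f) {C : ℝ} (hC : 0 ≤ C)
    (hfb : ∀ y, |f y| ≤ C * Real.exp (ϑ * (pinnedChain ω₂ lam β γ).hamiltonian N y))
    (hf0 : ∫ y, f y ∂((pinnedChain ω₂ lam β γ).gibbsMeasure N T) = 0) (z : PhaseSpace N) :
    |∫ t in Ioi (0 : ℝ), ∫ y, f y ∂((pinnedChain ω₂ lam β γ).transitionKernel N T T t.toNNReal z)| ≤
      K * C * Real.exp (ϑ * (pinnedChain ω₂ lam β γ).hamiltonian N z) / c := by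
  obtain ⟨-, hpt⟩ := pinnedChain_integrableOn_kubo hω hl hβ hγ hb hc hf hC hfb hf0 z
  set E := Real.exp (ϑ * (pinnedChain ω₂ lam β γ).hamiltonian N z) with hE
  have hdecay : IntegrableOn (fun t : ℝ => K * C * E * Real.exp (-c * t)) (Ioi 0) :=
    (exp_neg_integrableOn_Ioi 0 hc).const_mul _
  have hbd : ∀ᵐ t ∂(volume.restrict (Ioi (0 : ℝ))),
      ‖∫ y, f y ∂((pinnedChain ω₂ lam β γ).transitionKernel N T T t.toNNReal z)‖ ≤ K * C * E * Real.exp (-c * t) :=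
    (ae_restrict_iff' measurableSet_Ioi).2 (Eventually.of_forall fun t ht => by
      rw [Real.norm_eq_abs]; exact hpt t (le_of_lt (show (0:ℝ) < t from ht)))
  have h := norm_integral_le_of_norm_le hdecay hbd
  rw [Real.norm_eq_abs, integral_const_mul, integral_exp_neg_mul_Ioi' hc] at h
  calc _ ≤ K * C * E * (1 / c) := h
    _ = K * C * E / c := by ring

omit hβ hγ hN hT in
/-- `z ↦ R₀ f(z) = ∫_{(0,∞)} P_t f(z) dt` is (strongly) measurable. [folklore] -/
theorem pinnedChain_stronglyMeasurable_kubo (hβ' : 0 ≤ β) (hγ' : 0 ≤ γ) (T_L T_R : ℝ)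
    {f : PhaseSpace N → ℝ} (hf : Measurable f) :
    StronglyMeasurable fun z : PhaseSpace N => ∫ t in Ioi (0 : ℝ),
      ∫ y, f y ∂((pinnedChain ω₂ lam β γ).transitionKernel N T_L T_R t.toNNReal z) :=
  StronglyMeasurable.integral_prod_left' (μ := volume.restrict (Ioi (0 : ℝ)))
    (pinnedChain_stronglyMeasurable_act_uncurry hω hl hβ' hγ' T_L T_R hf)

omit hN hT in
/-- **The finite-horizon Kubo integrals converge**: `∫_{(0,τ]} P_t f(z) dt → R₀ f(z)` as `τ → ∞`, for
a centred nice `f` and EVERY `z`. [folklore] -/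
theorem pinnedChain_tendsto_kubo {ϑ K c : ℝ}
    (hb : ∀ (z : PhaseSpace N) (t : ℝ≥0) (f : PhaseSpace N → ℝ), Continuous f →
      ∀ C : ℝ, 0 ≤ C → (∀ y, |f y| ≤ C * Real.exp (ϑ * (pinnedChain ω₂ lam β γ).hamiltonian N y)) →
      |(∫ y, f y ∂((pinnedChain ω₂ lam β γ).transitionKernel N T T t z)) -
          ∫ y, f y ∂((pinnedChain ω₂ lam β γ).gibbsMeasure N T)| ≤
        K * C * Real.exp (ϑ * (pinnedChain ω₂ lam β γ).hamiltonian N z) * Real.exp (-c * t))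
    (hc : 0 < c) {f : PhaseSpace N → ℝ} (hf : Continuous f) {C : ℝ} (hC : 0 ≤ C)
    (hfb : ∀ y, |f y| ≤ C * Real.exp (ϑ * (pinnedChain ω₂ lam β γ).hamiltonian N y))
    (hf0 : ∫ y, f y ∂((pinnedChain ω₂ lam β γ).gibbsMeasure N T) = 0) (z : PhaseSpace N) :
    Tendsto (fun τ : ℝ => ∫ t in Set.Ioc (0 : ℝ) τ,
        ∫ y, f y ∂((pinnedChain ω₂ lam β γ).transitionKernel N T T t.toNNReal z)) atTop
      (𝓝 (∫ t in Ioi (0 : ℝ), ∫ y, f y ∂((pinnedChain ω₂ lam β γ).transitionKernel N T T t.toNNReal z))) := by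
  obtain ⟨hint, -⟩ := pinnedChain_integrableOn_kubo hω hl hβ hγ hb hc hf hC hfb hf0 z
  have h := intervalIntegral_tendsto_integral_Ioi 0 hint tendsto_id
  refine h.congr' ?_
  filter_upwards [eventually_ge_atTop (0 : ℝ)] with τ hτ
  show ∫ x in (0 : ℝ)..τ, _ = _
  rw [intervalIntegral.integral_of_le hτ]

omit hN hT in
/-- **`R_λ f → R₀ f` with rate**: `|R_λ f(z) - R₀ f(z)| ≤ λ K C e^{ϑH(z)} / c²` for a centred nice `f`
and `λ > 0` (`1 - e^{-λt} ≤ λt` and `∫₀^∞ t e^{-ct} ≤ 1/c²`, here through `e^{-ct}(1 - e^{-λt})` and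
the elementary bound `1 - e^{-λt} ≤ λ/c · e^{ct/2}`-free estimate `∫ (e^{-ct} - e^{-(c+λ)t}) = λ/(c(c+λ))`).
[folklore] -/
theorem pinnedChain_abs_resolvent_sub_kubo_le {ϑ K c : ℝ} (hϑ0 : 0 < ϑ)
    (hb : ∀ (z : PhaseSpace N) (t : ℝ≥0) (f : PhaseSpace N → ℝ), Continuous f →
      ∀ C : ℝ, 0 ≤ C → (∀ y, |f y| ≤ C * Real.exp (ϑ * (pinnedChain ω₂ lam β γ).hamiltonian N y)) →
      |(∫ y, f y ∂((pinnedChain ω₂ lam β γ).transitionKernel N T T t z)) -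
          ∫ y, f y ∂((pinnedChain ω₂ lam β γ).gibbsMeasure N T)| ≤
        K * C * Real.exp (ϑ * (pinnedChain ω₂ lam β γ).hamiltonian N z) * Real.exp (-c * t))
    (hc : 0 < c) {f : PhaseSpace N → ℝ} (hf : Continuous f) {C : ℝ} (hC : 0 ≤ C)
    (hfb : ∀ y, |f y| ≤ C * Real.exp (ϑ * (pinnedChain ω₂ lam β γ).hamiltonian N y))
    (hf0 : ∫ y, f y ∂((pinnedChain ω₂ lam β γ).gibbsMeasure N T) = 0)
    {lam' : ℝ} (hlam : 0 < lam') (z : PhaseSpace N) :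
    |(∫ t in Ioi (0 : ℝ), Real.exp (-(lam' * t)) *
        ∫ y, f y ∂((pinnedChain ω₂ lam β γ).transitionKernel N T T t.toNNReal z)) -
        ∫ t in Ioi (0 : ℝ), ∫ y, f y ∂((pinnedChain ω₂ lam β γ).transitionKernel N T T t.toNNReal z)| ≤
      lam' * (K * C * Real.exp (ϑ * (pinnedChain ω₂ lam β γ).hamiltonian N z)) / c ^ 2 := by
  set P := pinnedChain ω₂ lam β γ with hP
  set E := Real.exp (ϑ * P.hamiltonian N z) with hE
  set u : ℝ → ℝ := fun t => ∫ y, f y ∂(P.transitionKernel N T T t.toNNReal z) with hu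
  obtain ⟨hint, hpt⟩ := pinnedChain_integrableOn_kubo hω hl hβ hγ hb hc hf hC hfb hf0 z
  have iwu : IntegrableOn (fun t => Real.exp (-(lam' * t)) * u t) (Ioi 0) :=
    pinnedChain_integrableOn_resolvent hω hl hβ hγ hϑ0 hb hc hf hC hfb hlam z
  rw [← integral_sub iwu hint]
  -- `|e^{-λt} u - u| = (1 - e^{-λt}) |u| ≤ K C E (e^{-ct} - e^{-(c+λ)t})`
  have hd1 : IntegrableOn (fun t : ℝ => Real.exp (-c * t)) (Ioi 0) := exp_neg_integrableOn_Ioi 0 hc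
  have hd2 : IntegrableOn (fun t : ℝ => Real.exp (-(c + lam') * t)) (Ioi 0) := exp_neg_integrableOn_Ioi 0 (by linarith)
  have hdecay : IntegrableOn (fun t : ℝ => K * C * E * (Real.exp (-c * t) - Real.exp (-(c + lam') * t))) (Ioi 0) :=
    (hd1.sub hd2).const_mul _
  have hbd : ∀ᵐ t ∂(volume.restrict (Ioi (0 : ℝ))), ‖Real.exp (-(lam' * t)) * u t - u t‖ ≤
      K * C * E * (Real.exp (-c * t) - Real.exp (-(c + lam') * t)) := by
    refine (ae_restrict_iff' measurableSet_Ioi).2 (Eventually.of_forall fun t ht => ?_)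
    have ht' : 0 < t := ht
    have h := hpt t ht'.le
    have hw1 : Real.exp (-(lam' * t)) ≤ 1 := Real.exp_le_one_iff.2 (by nlinarith)
    have e : Real.exp (-(lam' * t)) * u t - u t = -((1 - Real.exp (-(lam' * t))) * u t) := by ring
    rw [e, norm_neg, norm_mul, Real.norm_eq_abs, Real.norm_eq_abs, abs_of_nonneg (by linarith)]
    have hprod : Real.exp (-c * t) - Real.exp (-(c + lam') * t) = Real.exp (-c * t) * (1 - Real.exp (-(lam' * t))) := by
      rw [mul_sub, mul_one, ← Real.exp_add]; ring_nf
    rw [hprod]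
    have h1 : 0 ≤ 1 - Real.exp (-(lam' * t)) := by linarith
    calc (1 - Real.exp (-(lam' * t))) * |u t| ≤ (1 - Real.exp (-(lam' * t))) * (K * C * E * Real.exp (-c * t)) :=
          mul_le_mul_of_nonneg_left h h1
      _ = K * C * E * (Real.exp (-c * t) * (1 - Real.exp (-(lam' * t)))) := by ring
  have h := norm_integral_le_of_norm_le hdecay hbd
  rw [Real.norm_eq_abs, integral_const_mul, integral_sub hd1 hd2, integral_exp_neg_mul_Ioi' hc,
    integral_exp_neg_mul_Ioi' (by linarith : 0 < c + lam')] at h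
  have hKCE : 0 ≤ K * C * E := by
    have := (abs_nonneg _).trans (hpt 0 le_rfl)
    simpa using this
  calc _ ≤ K * C * E * (1 / c - 1 / (c + lam')) := h
    _ = lam' * (K * C * E) / (c * (c + lam')) := by field_simp; ring
    _ ≤ lam' * (K * C * E) / c ^ 2 := by
        apply div_le_div_of_nonneg_left (by positivity) (by positivity)
        nlinarith

end Pinned

end Summit.AtomisticToContinuum.FouriersLaw.Theorems.OddSectorIrreversibility

end
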